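import Summits.CriticalPhenomena.PercolationContinuityZ3.Theorems.PercNearOneGluingNoHeavyLowerTailNineTypeKernelsAll

/-!
# The ORIENTED two-map nine-type count (OTA): two nested monotone cell maps

Support file for crux `stmt-CriticalPhenomena-4575` (master-family programme, quadratic four-point row `Q44b` and its
pencil / two-weight companions), seat `prim-l12-p6` gen 14; memo
`run/shared/lean/prim/prim-l12/FROM-prim-l12-p6-g14-OTA-KERNEL-AND-COMB3.md`.  Pure finite combinatorics; no named facts, no sorries, no new
definitions.

`NineType.card_bad_le_card_good` (`prim-bnk-1` gen 19, `…NineTypeCount`) is stated for an ABSTRACT configuration: bad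
points with types subject to CONT/COV and an up-set of goods closed under the HL/HH rules.  `…NineTypeKernelsAll`
instantiates it with ONE monotone cell map `ι` (heavy cell `ι T`, light cell `ι Tᶜ`) — the antipodal / `Q44b ∀n` statement.
Here we record that the SAME abstract theorem also covers TWO NESTED monotone cell maps `σ ≤ τ` (heavy cell read by the
bigger map `τ` on `T`, light cell read by the smaller map `σ` on `Tᶜ`):

  `#{T : (τ T, σ Tᶜ) is the (heavy, light) pair of a type in S} ≤ #{T : τ T ∈ AC ∧ σ Tᶜ = ⊥}`   (`twoMap_card_bad_le_card_good`)

for every `S ⊆ {1,…,9}`, every finite ground type and all monotone `σ τ : Finset γ → Fin 15` with `σ ≤ τ` pointwise.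
This is the lattice-level "oriented two-map antipodal positivity" OTA conjectured in `prim-l12-p6` gen 9
(`FROM-prim-l12-p6-g9-ORIENTED-ANTIPODAL.md` §1; exhaustive through `B_4`, SAT-certified through `B_5`, open since): the
bigger map sits in the heavy slot.  Every hypothesis of the abstract world transfers because the four derived facts
(`cellMap_cont`, `cellMap_union_ne_univ`, `cellMap_hl_good`, `cellMap_hh_good` of `…NineTypeCellCount`) only ever compare a
light cell UPWARDS with a heavy cell, which `σ ≤ τ` permits (`twoMap_cont`, `twoMap_union_ne_univ`, `twoMap_goods_upper`,
`twoMap_hl_good`, `twoMap_hh_good`).  (The INT fact `cellMap_inter_nonempty` does NOT transfer and is not needed.)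

Instances (all lattice level; see the memo for the law-level reading):
* `σ = τ = ι` is the one-map cell count (`goodKernel_kerS_all`);
* GRAPH-OTA `ĝ_H(F) = Σ_{S ⊇ F} K(π S, π(E∖S)) ≥ 0` (a set `F` of edges forced red; `prim-l12-p6` gen 12 §2, 0 negatives on
  5.9·10¹¹ pairs at 8 vertices) is the instance `γ = E ∖ F`, `τ T = cell(T ∪ F)`, `σ T = cell(T)`;
* the fibre form of the 'big-first' mixed Bernstein coefficient `B10(e) ≥ 0` of the `Q44b` pencil at EVERY edge type
  (`MIX-SECTORS` (ii), `ttrl3`, 0 / 1.69–2.4·10⁹) is the instance `F = {e}`; with `…TwoCopyMonotoneBridge`-type expansions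
  these give the law-level two-weight statements (not formalised here).
Also recorded: the signed-count form `0 ≤ Σ_T kerS S (τ T) (σ Tᶜ)` (`twoMap_sum_kerS_nonneg`).
-/

namespace Summit.CriticalPhenomena.PercolationContinuityZ3.Theorems

namespace TwoCopyMono

open Finset FourPointAtoms

/-- The Boolean cell order `ple` is transitive. [this work] -/
theorem ple_trans {i j k : Fin 15} (h1 : ple i j = true) (h2 : ple j k = true) : ple i k = true := by
  unfold ple at h1 h2 ⊢
  rw [decide_eq_true_iff] at h1 h2 ⊢
  exact fun a b hab => h2 a b (h1 a b hab)

/-! ## Two nested monotone cell maps: the hypotheses of the abstract world still come for free -/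

section TwoMap

variable {γ : Type*} [Fintype γ] [DecidableEq γ] (τ σ : Finset γ → Fin 15)
  (hτ : ∀ A B : Finset γ, A ⊆ B → ple (τ A) (τ B) = true)
  (hσ : ∀ A B : Finset γ, A ⊆ B → ple (σ A) (σ B) = true)
  (hστ : ∀ A : Finset γ, ple (σ A) (τ A) = true)
  (𝒯 : Finset (Finset γ)) (θ : Finset γ → ℕ)
  (𝔊 : Finset (Finset γ))

include hτ hσ in
/-- CONT for two maps: a bad point inside a bad point has a compatible type (heavy cells by `τ`, light cells by `σ`).
[this work] -/
theorem twoMap_cont (hθ : ∀ t ∈ 𝒯, θ t ∈ (Finset.Icc 1 9 : Finset ℕ))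
    (hh : ∀ t ∈ 𝒯, hIdx (θ t) = τ t) (hl : ∀ t ∈ 𝒯, lIdx (θ t) = σ tᶜ) :
    ∀ s ∈ 𝒯, ∀ t ∈ 𝒯, s ⊆ t → (θ s, θ t) ∈ NineType.contPairs := by
  intro s hs t ht hst
  apply cont_table _ (hθ s hs) _ (hθ t ht)
  · rw [hh s hs, hh t ht]; exact hτ _ _ hst
  · rw [hl s hs, hl t ht]; exact hσ _ _ (Finset.compl_subset_compl.2 hst)

include hσ hστ in
/-- COV for two maps: two bad points never cover the ground set (uses `σ ≤ τ`). [this work] -/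
theorem twoMap_union_ne_univ (hθ : ∀ t ∈ 𝒯, θ t ∈ (Finset.Icc 1 9 : Finset ℕ))
    (hh : ∀ t ∈ 𝒯, hIdx (θ t) = τ t) (hl : ∀ t ∈ 𝒯, lIdx (θ t) = σ tᶜ) :
    ∀ s ∈ 𝒯, ∀ t ∈ 𝒯, s ∪ t ≠ Finset.univ := by
  intro s hs t ht hU
  have h1 : tᶜ ⊆ s := by
    intro e he; rw [Finset.mem_compl] at he
    have : e ∈ s ∪ t := hU ▸ Finset.mem_univ e
    rcases Finset.mem_union.1 this with h | h
    · exact h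
    · exact absurd h he
  have h2 : sᶜ ⊆ t := by
    intro e he; rw [Finset.mem_compl] at he
    have : e ∈ s ∪ t := hU ▸ Finset.mem_univ e
    rcases Finset.mem_union.1 this with h | h
    · exact absurd h he
    · exact h
  apply cov_table _ (hθ s hs) _ (hθ t ht)
  refine ⟨?_, ?_⟩
  · rw [hl s hs, hh t ht]; exact ple_trans (hσ _ _ h2) (hστ t)
  · rw [hl t ht, hh s hs]; exact ple_trans (hσ _ _ h1) (hστ s)

include hτ hσ in
/-- The two-map goods `{T : τ T ∈ AC, σ Tᶜ = ⊥}` form an up-set. [this work] -/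
theorem twoMap_goods_upper (h𝔊 : ∀ T, T ∈ 𝔊 ↔ isAC (τ T) ∧ σ Tᶜ = 0) :
    IsUpperSet (𝔊 : Set (Finset γ)) := by
  intro A B hAB hA
  rw [Finset.mem_coe, h𝔊] at hA ⊢
  refine ⟨ac_up_bot_down.1 _ _ hA.1 (hτ _ _ hAB), ac_up_bot_down.2 _ ?_⟩
  rw [← hA.2]
  exact hσ _ _ (Finset.compl_subset_compl.2 hAB)

include hτ hσ hστ in
/-- HL-forced goods for two maps: `t ∪ t'ᶜ` is good when `hlOK (θ t) (θ t')` (uses `σ ≤ τ` twice). [this work] -/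
theorem twoMap_hl_good (hθ : ∀ t ∈ 𝒯, θ t ∈ (Finset.Icc 1 9 : Finset ℕ))
    (hh : ∀ t ∈ 𝒯, hIdx (θ t) = τ t) (hl : ∀ t ∈ 𝒯, lIdx (θ t) = σ tᶜ)
    (h𝔊 : ∀ T, T ∈ 𝔊 ↔ isAC (τ T) ∧ σ Tᶜ = 0) :
    ∀ t ∈ 𝒯, ∀ t' ∈ 𝒯, NineType.hlOK (θ t) (θ t') = true → t ∪ t'ᶜ ∈ 𝔊 := by
  intro t ht t' ht' hok
  rw [h𝔊]
  refine ⟨?_, ?_⟩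
  · apply hl_table_join _ (hθ t ht) _ (hθ t' ht') hok
    · rw [hh t ht]; exact hτ _ _ Finset.subset_union_left
    · rw [hl t' ht']; exact ple_trans (hστ _) (hτ _ _ Finset.subset_union_right)
  · apply hl_table_meet _ (hθ t ht) _ (hθ t' ht') hok
    · rw [hl t ht]; apply hσ
      intro e he
      rw [Finset.mem_compl, Finset.mem_union, not_or] at he
      exact Finset.mem_compl.2 he.1
    · rw [hh t' ht']
      refine ple_trans (hσ _ _ ?_) (hστ t')
      intro e he
      rw [Finset.mem_compl, Finset.mem_union, not_or, Finset.mem_compl, not_not] at he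
      exact he.2

include hτ hσ in
/-- HH-forced goods for two maps: `t ∪ t'` is good when `hhOK (θ t) (θ t')`. [this work] -/
theorem twoMap_hh_good (hθ : ∀ t ∈ 𝒯, θ t ∈ (Finset.Icc 1 9 : Finset ℕ))
    (hh : ∀ t ∈ 𝒯, hIdx (θ t) = τ t) (hl : ∀ t ∈ 𝒯, lIdx (θ t) = σ tᶜ)
    (h𝔊 : ∀ T, T ∈ 𝔊 ↔ isAC (τ T) ∧ σ Tᶜ = 0) :
    ∀ t ∈ 𝒯, ∀ t' ∈ 𝒯, NineType.hhOK (θ t) (θ t') = true → t ∪ t' ∈ 𝔊 := by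
  intro t ht t' ht' hok
  rw [h𝔊]
  refine ⟨?_, ?_⟩
  · apply hh_table_join _ (hθ t ht) _ (hθ t' ht') hok
    · rw [hh t ht]; exact hτ _ _ Finset.subset_union_left
    · rw [hh t' ht']; exact hτ _ _ Finset.subset_union_right
  · apply hh_table_meet _ (hθ t ht) _ (hθ t' ht') hok
    · rw [hl t ht]; apply hσ
      intro e he
      rw [Finset.mem_compl, Finset.mem_union, not_or] at he
      exact Finset.mem_compl.2 he.1
    · rw [hl t' ht']; apply hσ
      intro e he
      rw [Finset.mem_compl, Finset.mem_union, not_or] at he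
      exact Finset.mem_compl.2 he.2

end TwoMap

/-! ## The oriented two-map count -/

/-- **OTA — the oriented two-map nine-type count.**  For every `S ⊆ {1,…,9}`, every finite type `γ` and all monotone cell
maps `σ τ : Finset γ → Fin 15` with `σ ≤ τ` pointwise, the points `T` whose pair (heavy `τ T`, light `σ Tᶜ`) is a bad pair of
a type in `S` are at most as many as the points with `τ T ∈ AC` and `σ Tᶜ = ⊥`.  (`σ = τ` is the antipodal cell count behind
`Q44b ∀n`; `τ = cell(· ∪ F)`, `σ = cell` on `E ∖ F` is graph-OTA / the fibre form of `B10 ≥ 0`.)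
[this work; combinatorial content `NineType.card_bad_le_card_good`, prim-bnk-1 gen 19] -/
theorem twoMap_card_bad_le_card_good (S : Finset ℕ) (hS : ∀ θ ∈ S, 1 ≤ θ ∧ θ ≤ 9)
    {γ : Type*} [Fintype γ] [DecidableEq γ] (τ σ : Finset γ → Fin 15)
    (hτ : ∀ A B : Finset γ, A ⊆ B → ple (τ A) (τ B) = true)
    (hσ : ∀ A B : Finset γ, A ⊆ B → ple (σ A) (σ B) = true)
    (hστ : ∀ A : Finset γ, ple (σ A) (τ A) = true) :
    #(Finset.univ.filter fun T => badS S (τ T) (σ Tᶜ)) ≤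
      #(Finset.univ.filter fun T => isAC (τ T) ∧ σ Tᶜ = 0) := by
  classical
  set 𝒯 : Finset (Finset γ) := Finset.univ.filter (fun T => badS S (τ T) (σ Tᶜ)) with h𝒯
  set 𝔊 : Finset (Finset γ) := Finset.univ.filter (fun T => isAC (τ T) ∧ σ Tᶜ = 0) with h𝔊
  have h𝔊mem : ∀ T, T ∈ 𝔊 ↔ isAC (τ T) ∧ σ Tᶜ = 0 := by
    intro T; rw [h𝔊, Finset.mem_filter]; simp
  have h𝒯mem : ∀ T, T ∈ 𝒯 → badS S (τ T) (σ Tᶜ) := by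
    intro T hT; rw [h𝒯, Finset.mem_filter] at hT; exact hT.2
  -- a type function for the bad points
  have htyp : ∀ T ∈ 𝒯, ∃ θ ∈ S, hIdx θ = τ T ∧ lIdx θ = σ Tᶜ := fun T hT => h𝒯mem T hT
  choose! θf hθS hθh hθl using htyp
  have hθ9 : ∀ t ∈ 𝒯, θf t ∈ (Finset.Icc 1 9 : Finset ℕ) := fun t ht => Finset.mem_Icc.2 (hS _ (hθS t ht))
  have hθ : ∀ t ∈ 𝒯, 1 ≤ θf t ∧ θf t ≤ 9 := fun t ht => hS _ (hθS t ht)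
  have hcont := twoMap_cont τ σ hτ hσ 𝒯 θf hθ9 hθh hθl
  have hcov' := twoMap_union_ne_univ τ σ hσ hστ 𝒯 θf hθ9 hθh hθl
  have hcov : ∀ s ∈ 𝒯, ∀ s' ∈ 𝒯, s ≠ s' → s ∪ s' ≠ Finset.univ := fun s hs s' hs' _ => hcov' s hs s' hs'
  have hGup : IsUpperSet (𝔊 : Set (Finset γ)) := twoMap_goods_upper τ σ hτ hσ 𝔊 h𝔊mem
  have hG : ∀ g ∈ 𝔊, ∀ g' : Finset γ, g ⊆ g' → g' ∈ 𝔊 := fun g hg g' hgg' => hGup hgg' hg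
  have hHL := twoMap_hl_good τ σ hτ hσ hστ 𝒯 θf 𝔊 hθ9 hθh hθl h𝔊mem
  have hHH' := twoMap_hh_good τ σ hτ hσ 𝒯 θf 𝔊 hθ9 hθh hθl h𝔊mem
  have hHH : ∀ s ∈ 𝒯, ∀ s' ∈ 𝒯, s ≠ s' → NineType.hhOK (θf s) (θf s') = true → s ∪ s' ∈ 𝔊 :=
    fun s hs s' hs' _ hok => hHH' s hs s' hs' hok
  exact NineType.card_bad_le_card_good 𝒯 θf hθ hcont hcov 𝔊 hG hHL hHH

/-- **OTA, signed-count form.**  With the nine-type kernel `kerS S` of a type set `S ⊆ {1,…,9}`: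
`0 ≤ Σ_T kerS S (τ T) (σ Tᶜ)` for all monotone `σ ≤ τ`. [this work] -/
theorem twoMap_sum_kerS_nonneg (S : Finset ℕ) (hS : ∀ θ ∈ S, 1 ≤ θ ∧ θ ≤ 9)
    {γ : Type*} [Fintype γ] [DecidableEq γ] (τ σ : Finset γ → Fin 15)
    (hτ : ∀ A B : Finset γ, A ⊆ B → ple (τ A) (τ B) = true)
    (hσ : ∀ A B : Finset γ, A ⊆ B → ple (σ A) (σ B) = true)
    (hστ : ∀ A : Finset γ, ple (σ A) (τ A) = true) :
    0 ≤ ∑ T : Finset γ, kerS S (τ T) (σ Tᶜ) := by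
  classical
  have h1 : ∀ T : Finset γ, kerS S (τ T) (σ Tᶜ) =
      (if isAC (τ T) ∧ σ Tᶜ = 0 then (1 : ℤ) else 0) - (if badS S (τ T) (σ Tᶜ) then (1 : ℤ) else 0) := by
    intro T; rfl
  simp_rw [h1]
  rw [Finset.sum_sub_distrib, Finset.sum_boole, Finset.sum_boole]
  have h := twoMap_card_bad_le_card_good S hS τ σ hτ hσ hστ
  have h' : (#(Finset.univ.filter fun T => badS S (τ T) (σ Tᶜ)) : ℤ) ≤
      (#(Finset.univ.filter fun T => isAC (τ T) ∧ σ Tᶜ = 0) : ℤ) := by exact_mod_cast h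
  linarith

/-- **Graph-OTA / forced red set, lattice form.**  For ONE monotone cell map `ι` on the subsets of `γ` and any fixed
`F : Finset γ` disjoint bookkeeping aside, the pair of maps `τ T = ι (T ∪ F)`, `σ = ι` is nested, so the count of
`twoMap_card_bad_le_card_good` applies: `#{T : (ι (T ∪ F), ι Tᶜ) bad of a type in S} ≤ #{T : ι (T ∪ F) ∈ AC ∧ ι Tᶜ = ⊥}`.
(For the graph count `ĝ_H(F)` take `γ = E ∖ F` and `ι` the cell map of `H` with `F`'s complement inside `γ`.) [this work] -/
theorem forced_card_bad_le_card_good (S : Finset ℕ) (hS : ∀ θ ∈ S, 1 ≤ θ ∧ θ ≤ 9)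
    {γ : Type*} [Fintype γ] [DecidableEq γ] (ι : Finset γ → Fin 15)
    (hmono : ∀ A B : Finset γ, A ⊆ B → ple (ι A) (ι B) = true) (F : Finset γ) :
    #(Finset.univ.filter fun T => badS S (ι (T ∪ F)) (ι Tᶜ)) ≤
      #(Finset.univ.filter fun T => isAC (ι (T ∪ F)) ∧ ι Tᶜ = 0) :=
  twoMap_card_bad_le_card_good S hS (fun T => ι (T ∪ F)) ι
    (fun _ _ hAB => hmono _ _ (Finset.union_subset_union hAB (subset_refl F)))
    hmono (fun _ => hmono _ _ Finset.subset_union_left)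

end TwoCopyMono

end Summit.CriticalPhenomena.PercolationContinuityZ3.Theorems
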